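import Mathlib
import Summits.Ventures.HodgeRepro.Tier4.Line1.RTFSetting
import Summits.Ventures.HodgeRepro.Tier4.Line1.RtfSpectral

/-!
# Tier4/Line1/SpectralRegroup — W4 (V4.2): from L1's spectral expansion `rtf_spectral` to a FINITE two-torus
spectral expansion over admissible constituents, with the Riesz vectors of the `T′`-period (the Riesz/Parseval bridge)

Blind re-derivation cell `pub-hodge-repro`, Tier 4 (README §9–§10), seat t4-L1-p5 (prover, LINE L1, gen 2; the lead's
cut S13277 for LINE L4's W4, shape adjudicated by t4-L4-p1).  On the generic `RTF.Setting` of LINE L1 (plan-1's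
`RTFSetting`, t4-L1-p4's `rtf_spectral`): the spectral expansion `J(f₁ ⋆ f₂) = ∑_j P_{χ′}(R(f₂ˇ)φ_j) · conj P_χ(R(f̄₁)φ_j)`
over an adapted orthonormal basis is REGROUPED over finitely many pairwise disjoint blocks `F i` of the basis (the
admissible constituents: the `K`-type spaces of the irreducible `τ` hit by the admissible projector) on which the two
kernel operators act by the DISPLAYED scalars `a i`, `b i` (the Hecke eigen-relations) and outside which `R(f̄₁)` kills
the basis vectors (the admissible projector): `J(f₁ ⋆ f₂) = ∑_i b_i conj(a_i) ∑_{j ∈ F i} P_{χ′}(φ_j) conj P_χ(φ_j)`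
(`J_eq_sum_constituents`, no integrability needed — a rearrangement of a summable series with finite support); and
the inner sum is `conj P_χ(v′_i)` for `v′_i := rieszOf (F i) φ (P_{χ′}) = ∑_{j ∈ F i} conj(P_{χ′}(φ_j)) φ_j`, the RIESZ VECTOR of
the `T′`-period on the span of the block for the `L²(D_G)` pairing `S.inner` (`inner_rieszOf`: `⟪φ_j, v′⟫ = P_{χ′}(φ_j)`;
`J_eq_sum_riesz`).  Nothing here asserts the finiteness of the admissible spectrum, the eigen-relations or the
vanishing — they are the automorphic inputs of W4 and stay displayed (crit-2's R2 caveat).  Mathlib + the line's modules.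

Nothing here says anything about the status of the Hodge conjecture for CM abelian varieties, which is NOT proved
(HC_CM is NOT proved by anyone in this repository).
-/

set_option autoImplicit false

noncomputable section

namespace Summit.Ventures.HodgeRepro.Tier4.Line1

open MeasureTheory Topology

namespace RTF

variable {G : Type} [Group G] [TopologicalSpace G] [IsTopologicalGroup G] [MeasurableSpace G]
  [BorelSpace G]

namespace Setting

variable (S : Setting G)

section Riesz

/-- **the Riesz vector** of a functional `P` on the span of the orthonormal family `φ j`, `j ∈ F`:
`v′ = ∑_{j ∈ F} conj(P(φ_j)) · φ_j`, so that `⟪φ_j, v′⟫ = P(φ_j)` for the pairing `inner φ ψ = ∫_{D_G} φ · conj ψ`. -/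
def rieszOf (F : Finset ℕ) (φ : ℕ → G → ℂ) (P : (G → ℂ) → ℂ) : G → ℂ :=
  fun x => ∑ j ∈ F, starRingEnd ℂ (P (φ j)) * φ j x

omit [IsTopologicalGroup G] in
/-- a continuous function times the conjugate of a continuous function is integrable on a set with compact closure
(for a measure finite on compacts) -/
theorem integrableOn_mul_conj_of_continuous {X : Type} [TopologicalSpace X] [MeasurableSpace X]
    [OpensMeasurableSpace X] (ν : Measure X) [IsFiniteMeasureOnCompacts ν] {D : Set X}
    (hD : IsCompact (closure D)) {φ ψ : X → ℂ} (hφ : Continuous φ) (hψ : Continuous ψ) :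
    IntegrableOn (fun x => φ x * starRingEnd ℂ (ψ x)) D ν := by
  have h : IntegrableOn (fun x => φ x * starRingEnd ℂ (ψ x)) (closure D) ν :=
    (hφ.mul (Complex.continuous_conj.comp hψ)).continuousOn.integrableOn_compact' hD
      isClosed_closure.measurableSet
  exact h.mono_set subset_closure

omit [IsTopologicalGroup G] in
/-- the pairing is conjugate-linear in the second argument on finite sums of continuous functions -/
theorem inner_finset_sum_right (ψ : G → ℂ) (hψ : Continuous ψ) (F : Finset ℕ) (c : ℕ → ℂ)
    (φ : ℕ → G → ℂ) (hφ : ∀ j ∈ F, Continuous (φ j)) :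
    S.inner ψ (fun x => ∑ j ∈ F, c j * φ j x) = ∑ j ∈ F, starRingEnd ℂ (c j) * S.inner ψ (φ j) := by
  haveI := S.haar
  unfold inner
  have h1 : ∀ x, ψ x * starRingEnd ℂ (∑ j ∈ F, c j * φ j x) =
      ∑ j ∈ F, starRingEnd ℂ (c j) * (ψ x * starRingEnd ℂ (φ j x)) := by
    intro x
    rw [map_sum, Finset.mul_sum]
    refine Finset.sum_congr rfl fun j _ => ?_
    rw [map_mul]
    ring
  simp_rw [h1]
  rw [integral_finsetSum]
  · refine Finset.sum_congr rfl fun j hj => ?_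
    rw [integral_const_mul]
  · intro j hj
    exact (integrableOn_mul_conj_of_continuous S.μ S.compG hψ (hφ j hj)).const_mul _

omit [IsTopologicalGroup G] in
/-- **the Riesz identity**: `⟪φ_j, rieszOf F φ P⟫ = P(φ_j)` for `j ∈ F` and an adapted orthonormal basis -/
theorem inner_rieszOf {τ : ℕ → Set (G → ℂ)} {φ : ℕ → G → ℂ} {n : ℕ → ℕ} (hB : S.IsAdaptedONB τ φ n)
    (F : Finset ℕ) (P : (G → ℂ) → ℂ) {j : ℕ} (hj : j ∈ F) :
    S.inner (φ j) (rieszOf F φ P) = P (φ j) := by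
  have hcont : ∀ l, Continuous (φ l) := fun l => (hB.inv (n l)).cont _ (hB.mem l)
  unfold rieszOf
  rw [S.inner_finset_sum_right (φ j) (hcont j) F _ φ (fun l _ => hcont l)]
  simp only [Complex.conj_conj, hB.orth]
  rw [Finset.sum_eq_single j]
  · simp
  · intro l _ hl
    simp [Ne.symm hl]
  · intro h
    exact absurd hj h

end Riesz

section Regroup

variable {χ : S.T → ℂ} {χ' : S.T' → ℂ}

omit [IsTopologicalGroup G] [BorelSpace G] in
/-- the `T`-period is homogeneous -/
theorem periodT_const_mul (c : ℂ) (a : S.T → ℂ) :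
    S.periodT χ (fun t => c * a t) = c * S.periodT χ a := by
  unfold periodT
  simp_rw [mul_assoc]
  exact integral_const_mul c _

omit [IsTopologicalGroup G] [BorelSpace G] in
/-- the `T′`-period is homogeneous -/
theorem periodT'_const_mul (c : ℂ) (a : S.T' → ℂ) :
    S.periodT' χ' (fun t => c * a t) = c * S.periodT' χ' a := by
  unfold periodT'
  simp_rw [mul_assoc]
  exact integral_const_mul c _

omit [IsTopologicalGroup G] [BorelSpace G] in
/-- the `T`-period of the zero function vanishes -/
theorem periodT_zero : S.periodT χ (fun _ => 0) = 0 := by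
  unfold periodT
  simp

/-- **W4 (V4.2), THE REGROUPING**: over an adapted orthonormal basis, finitely many pairwise disjoint blocks `F i`
(the admissible constituents) on which `R(f̄₁)` and `R(f₂ˇ)` act by the scalars `a i`, `b i`, and outside which
`R(f̄₁)` vanishes, the spectral expansion of `J(f₁ ⋆ f₂)` is the FINITE sum
`∑_i b_i conj(a_i) ∑_{j ∈ F i} P_{χ′}(φ_j) conj P_χ(φ_j)`. -/
theorem J_eq_sum_constituents (hχ : S.IsCharacter χ) (hχ' : S.IsCharacter' χ')
    {τ : ℕ → Set (G → ℂ)} {φ : ℕ → G → ℂ} {n : ℕ → ℕ} (hB : S.IsAdaptedONB τ φ n)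
    {f₁ f₂ : G → ℂ} (h₁ : IsTest f₁) (h₂ : IsTest f₂) {m : ℕ} (F : Fin m → Finset ℕ)
    (hdisj : ∀ i i', i ≠ i' → Disjoint (F i) (F i')) (a b : Fin m → ℂ)
    (ha : ∀ i, ∀ j ∈ F i, S.R (cj f₁) (φ j) = fun x => a i * φ j x)
    (hb : ∀ i, ∀ j ∈ F i, S.R (refl f₂) (φ j) = fun x => b i * φ j x)
    (hvan : ∀ j, (∀ i, j ∉ F i) → S.R (cj f₁) (φ j) = fun _ => 0) :
    S.J χ χ' (S.conv f₁ f₂) = ∑ i, b i * starRingEnd ℂ (a i) *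
      ∑ j ∈ F i, S.periodT' χ' (fun t' => φ j t') * starRingEnd ℂ (S.periodT χ (fun t => φ j t)) := by
  classical
  set term : ℕ → ℂ := fun j => S.periodT' χ' (fun t' => S.R (refl f₂) (φ j) t') *
    starRingEnd ℂ (S.periodT χ (fun t => S.R (cj f₁) (φ j) t)) with hterm
  have hsum : HasSum term (S.J χ χ' (S.conv f₁ f₂)) := S.rtf_spectral hχ hχ' hB h₁ h₂
  set U : Finset ℕ := Finset.univ.biUnion F with hU
  have hzero : ∀ j ∉ U, term j = 0 := by
    intro j hj
    have hnot : ∀ i, j ∉ F i := by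
      intro i hi
      exact hj (Finset.mem_biUnion.mpr ⟨i, Finset.mem_univ i, hi⟩)
    simp only [hterm]
    rw [hvan j hnot]
    simp only [periodT_zero, map_zero, mul_zero]
  have hfin : HasSum term (∑ j ∈ U, term j) := hasSum_sum_of_ne_finset_zero hzero
  rw [hsum.unique hfin, hU, Finset.sum_biUnion]
  · refine Finset.sum_congr rfl fun i _ => ?_
    rw [Finset.mul_sum]
    refine Finset.sum_congr rfl fun j hj => ?_
    simp only [hterm]
    rw [ha i j hj, hb i j hj]
    simp only []
    rw [periodT'_const_mul, periodT_const_mul, map_mul]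
    ring
  · intro i _ i' _ hii'
    exact hdisj i i' hii'

omit [IsTopologicalGroup G] in
/-- the `T`-period of a Riesz vector, expanded -/
theorem periodT_rieszOf {τ : ℕ → Set (G → ℂ)} {φ : ℕ → G → ℂ} {n : ℕ → ℕ} (hB : S.IsAdaptedONB τ φ n)
    (hχ : S.IsCharacter χ) (F : Finset ℕ) (P : (G → ℂ) → ℂ) :
    S.periodT χ (fun t => rieszOf F φ P t) =
      ∑ j ∈ F, starRingEnd ℂ (P (φ j)) * S.periodT χ (fun t => φ j t) := by
  haveI := S.haarT
  have hcont : ∀ l, Continuous (φ l) := fun l => (hB.inv (n l)).cont _ (hB.mem l)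
  unfold rieszOf periodT
  have h1 : ∀ t : S.T, (∑ j ∈ F, starRingEnd ℂ (P (φ j)) * φ j t) * starRingEnd ℂ (χ t) =
      ∑ j ∈ F, starRingEnd ℂ (P (φ j)) * (φ j t * starRingEnd ℂ (χ t)) := by
    intro t
    rw [Finset.sum_mul]
    refine Finset.sum_congr rfl fun j _ => ?_
    ring
  simp_rw [h1]
  rw [integral_finsetSum]
  · refine Finset.sum_congr rfl fun j _ => ?_
    rw [integral_const_mul]
  · intro j _
    refine ((integrableOn_mul_conj_of_continuous S.μT S.compT (X := S.T) ?_ hχ.cont)).const_mul _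
    exact (hcont j).comp continuous_subtype_val

/-- **W4 (V4.2), THE RIESZ FORM**: the regrouped expansion with each block's inner sum written as the conjugate
`T`-period of the Riesz vector `v′_i = rieszOf (F i) φ (periodT' χ')` of the `T′`-period on the block:
`J(f₁ ⋆ f₂) = ∑_i b_i conj(a_i) · conj P_χ(v′_i)`. -/
theorem J_eq_sum_riesz (hχ : S.IsCharacter χ) (hχ' : S.IsCharacter' χ')
    {τ : ℕ → Set (G → ℂ)} {φ : ℕ → G → ℂ} {n : ℕ → ℕ} (hB : S.IsAdaptedONB τ φ n)
    {f₁ f₂ : G → ℂ} (h₁ : IsTest f₁) (h₂ : IsTest f₂) {m : ℕ} (F : Fin m → Finset ℕ)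
    (hdisj : ∀ i i', i ≠ i' → Disjoint (F i) (F i')) (a b : Fin m → ℂ)
    (ha : ∀ i, ∀ j ∈ F i, S.R (cj f₁) (φ j) = fun x => a i * φ j x)
    (hb : ∀ i, ∀ j ∈ F i, S.R (refl f₂) (φ j) = fun x => b i * φ j x)
    (hvan : ∀ j, (∀ i, j ∉ F i) → S.R (cj f₁) (φ j) = fun _ => 0) :
    S.J χ χ' (S.conv f₁ f₂) = ∑ i, b i * starRingEnd ℂ (a i) *
      starRingEnd ℂ (S.periodT χ (fun t => rieszOf (F i) φ (fun ψ => S.periodT' χ' (fun t' => ψ t')) t)) := by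
  rw [S.J_eq_sum_constituents hχ hχ' hB h₁ h₂ F hdisj a b ha hb hvan]
  have hblock : ∀ i, starRingEnd ℂ (S.periodT χ
      (fun t => rieszOf (F i) φ (fun ψ => S.periodT' χ' (fun t' => ψ t')) t)) =
      ∑ j ∈ F i, S.periodT' χ' (fun t' => φ j t') * starRingEnd ℂ (S.periodT χ (fun t => φ j t)) := by
    intro i
    rw [S.periodT_rieszOf hB hχ (F i), map_sum]
    refine Finset.sum_congr rfl fun j _ => ?_
    rw [map_mul, Complex.conj_conj]
  refine Finset.sum_congr rfl fun i _ => ?_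
  rw [hblock i]

end Regroup

end Setting

end RTF

end Summit.Ventures.HodgeRepro.Tier4.Line1

end
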